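import Summits.CriticalPhenomena.Ising3DConformalLimit.Theses.PerfectScreening
import Literature.Probability.LatticeModels.CriticalAxisRatioRegularity
import Literature.Probability.LatticeModels.PointwiseScalingLimitEtaExists
import Literature.Probability.LatticeModels.CriticalTwoPointLawDimension
import HarnessLib

/-!
# `SubharmonicOffOrigin` (crux stmt-CriticalPhenomena-1341): the AXIS SUM RULE

Refuter file (cdisprove seat `refuter-cdisprove-stmt-CriticalPhenomena-1341-0`), sibling of
`AxisExactBalance.lean`, for the crux `SubH : ∀ x ≠ 0, 6·G(x) ≤ ∑ᵢ (G(x+eᵢ) + G(x−eᵢ))`,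
`G = criticalTwoPoint 3` (route `PerfectScreening`). QUANTITATIVE exact balance on the axis, from
Messager–Miracle-Solé and Abel summation alone. With `M n = G(n e₀)`, the axis Laplacian
`Λ(m) = ∑_nbrs G(m e₀) − 6 M(m)` and the transverse deficit `T(m) = 4 M(m) − ∑_{4 transverse nbrs} G`
(`≥ 0` by MMS) one has `Λ(m) + T(m) = M(m+1) − 2M(m) + M(m−1)`, whence

* `axis_sum_rule` (IDENTITY): `∑_{n<N} (n+1)(Λ(n+1) + T(n+1)) + M N + N (M N − M (N+1)) = G(0) = 1`;
* `sum_weighted_axisLaplacian_lt_one` (UNCONDITIONAL): `∑_{n<N} (n+1)·Λ(n+1) < 1` for every `N`;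
* `weighted_axisLaplacian_of_subharmonicOffOrigin` (CONDITIONAL): under SubH the weighted axis
  Laplacian `(n+1)Λ(n+1) ≥ 0` has partial sums `≤ 1` (a convergent series of total mass `≤ 1`:
  `liminf n²·ΔG(n e₀) = 0`);
* `relative_axisLaplacian_logSummable_of_subharmonicOffOrigin`: with Simon–Lieb `M(n) ≥ c/n²`,
  SubH ⟹ `∑_{n<N} (ΔG/G)((n+1)e₀)/(n+1) ≤ 1/c` — the relative excess is log-summable, a second and
  quantitative proof that SubH admits no uniform slack.

No statement of the route is asserted positively. References: Messager–Miracle-Solé 1977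
[MessagerMiracleSoleJSP1977]; B. Simon, CMP 77 (1980) [Simon1980]; Aizenman–Duminil-Copin 2021
[AizenmanDuminilCopinAnnals2021].
-/

noncomputable section

open Filter Topology Finset
open Literature.Probability.LatticeModels

namespace Summit.CriticalPhenomena.Ising3DConformalLimit.SubharmonicOffOriginAxisSumRule

/-! ### Axis toolkit -/

/-- Messager–Miracle-Solé in coordinates: a site with first coordinate `n ≥ 1` and all coordinates of
modulus `≤ n` (i.e. on the sup-sphere of radius `n`) has `G(y) ≤ G(n e₀)`. [folklore] -/
private theorem le_axis_of_coords {n : ℕ} (hn : 1 ≤ n) {y : Site 3} (h0 : y 0 = n)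
    (hle : ∀ j, (y j).natAbs ≤ n) :
    criticalTwoPoint 3 y ≤ criticalTwoPoint 3 (Pi.single 0 (n : ℤ)) := by
  have hs : Site.supNorm y = n := by
    refine le_antisymm (Site.supNorm_le_iff.2 hle) ?_
    have h := Site.natAbs_le_supNorm y 0
    rwa [h0, Int.natAbs_natCast] at h
  have h := (criticalTwoPoint_axis_sandwich (y := y) (by omega)).2
  rwa [hs] at h

/-- The four transverse neighbours of `n e₀` (`n ≥ 1`) are dominated by `G(n e₀)`. [folklore] -/
private theorem transverse_nbrs_le (n : ℕ) (hn : 1 ≤ n) :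
    criticalTwoPoint 3 (Pi.single 0 (n : ℤ) + Pi.single 1 1) ≤ criticalTwoPoint 3 (Pi.single 0 (n : ℤ)) ∧
    criticalTwoPoint 3 (Pi.single 0 (n : ℤ) - Pi.single 1 1) ≤ criticalTwoPoint 3 (Pi.single 0 (n : ℤ)) ∧
    criticalTwoPoint 3 (Pi.single 0 (n : ℤ) + Pi.single 2 1) ≤ criticalTwoPoint 3 (Pi.single 0 (n : ℤ)) ∧
    criticalTwoPoint 3 (Pi.single 0 (n : ℤ) - Pi.single 2 1) ≤ criticalTwoPoint 3 (Pi.single 0 (n : ℤ)) := by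
  refine ⟨le_axis_of_coords hn (by simp) ?_, le_axis_of_coords hn (by simp) ?_,
    le_axis_of_coords hn (by simp) ?_, le_axis_of_coords hn (by simp) ?_⟩ <;>
  · intro j
    fin_cases j <;> simp [hn]

/-- Axis bookkeeping: `n e₀ + e₀ = (n+1) e₀`. [folklore] -/
private theorem axis_add_one (n : ℕ) :
    (Pi.single 0 (n : ℤ) + Pi.single 0 1 : Site 3) = Pi.single 0 ((n + 1 : ℕ) : ℤ) := by
  rw [← Pi.single_add]; push_cast; rfl

/-- Axis bookkeeping: `(n+1) e₀ − e₀ = n e₀`. [folklore] -/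
private theorem axis_sub_one (n : ℕ) :
    (Pi.single 0 ((n + 1 : ℕ) : ℤ) - Pi.single 0 1 : Site 3) = Pi.single 0 (n : ℤ) := by
  rw [← Pi.single_sub]; push_cast; simp

/-- `n e₀ ≠ 0` for `n ≥ 1`. [folklore] -/
private theorem axis_ne_zero {n : ℕ} (hn : 1 ≤ n) : (Pi.single 0 (n : ℤ) : Site 3) ≠ 0 := by
  intro h
  have h0 := congrFun h 0
  simp at h0
  omega

/-! ### (b′) Quantitative exact balance: the axis sum rule -/

/-- Abel summation for second differences: `∑_{n<N} (n+1)·δ²M(n+1) = M 0 − M N − N·(M N − M (N+1))`.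
[folklore] -/
theorem sum_mul_secondDiff (M : ℕ → ℝ) (N : ℕ) :
    ∑ n ∈ range N, ((n : ℝ) + 1) * (M (n + 2) - 2 * M (n + 1) + M n) =
      M 0 - M N - N * (M N - M (N + 1)) := by
  induction N with
  | zero => simp
  | succ N ih =>
    rw [sum_range_succ, ih]
    push_cast
    ring

/-- The neighbour sum at `(n+1)e₀` splits into the two axial values and the transverse part. [folklore] -/
theorem nbrSum_axis_eq (n : ℕ) :
    ∑ i : Fin 3, (criticalTwoPoint 3 (Pi.single 0 ((n + 1 : ℕ) : ℤ) + Pi.single i 1) +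
        criticalTwoPoint 3 (Pi.single 0 ((n + 1 : ℕ) : ℤ) - Pi.single i 1)) =
      criticalTwoPoint 3 (Pi.single 0 ((n + 2 : ℕ) : ℤ)) + criticalTwoPoint 3 (Pi.single 0 (n : ℤ)) +
      ((criticalTwoPoint 3 (Pi.single 0 ((n + 1 : ℕ) : ℤ) + Pi.single 1 1) +
        criticalTwoPoint 3 (Pi.single 0 ((n + 1 : ℕ) : ℤ) - Pi.single 1 1)) +
       (criticalTwoPoint 3 (Pi.single 0 ((n + 1 : ℕ) : ℤ) + Pi.single 2 1) +
        criticalTwoPoint 3 (Pi.single 0 ((n + 1 : ℕ) : ℤ) - Pi.single 2 1))) := by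
  rw [Fin.sum_univ_three, axis_add_one (n + 1), axis_sub_one n]
  ring

/-- Simon–Lieb on the axis: `c/(n+1)² ≤ G((n+1)e₀)` (tree theorem `criticalTwoPoint_bounds_holds`).
[cite: Simon1980, Thm. 1] -/
theorem simon_axis : ∃ c : ℝ, 0 < c ∧ ∀ n : ℕ,
    c / ((n : ℝ) + 1) ^ 2 ≤ criticalTwoPoint 3 (Pi.single 0 ((n + 1 : ℕ) : ℤ)) := by
  obtain ⟨c, C, hc, hb⟩ := criticalTwoPoint_bounds_holds (d := 3) le_rfl
  refine ⟨c, hc, fun n => ?_⟩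
  have hx := axis_ne_zero (n := n + 1) (by omega)
  have h1 := (hb _ hx).1
  have hnorm : ‖(Pi.single 0 (((n + 1 : ℕ)) : ℤ) : Site 3)‖ = (n : ℝ) + 1 := by
    rw [Pi.norm_single, Int.norm_natCast]; push_cast; ring
  rw [hnorm] at h1
  have hexp : ((n : ℝ) + 1) ^ (-((((3 : ℕ) : ℝ)) - 1)) = (((n : ℝ) + 1) ^ 2)⁻¹ := by
    rw [show (-((((3 : ℕ) : ℝ)) - 1)) = -(2 : ℝ) by norm_num, Real.rpow_neg (by positivity), Real.rpow_two]
  rw [hexp] at h1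
  simpa [div_eq_mul_inv] using h1

/-- **AXIS SUM RULE (unconditional identity).** With `M n = G(n e₀)`, the axis Laplacian
`Λ(m) = ∑_nbrs G(m e₀) − 6 G(m e₀)` and the transverse deficit
`T(m) = 4 G(m e₀) − ∑_{transverse nbrs} G ≥ 0` one has `Λ(m) + T(m) = δ²M(m)`, whence by Abel
summation `∑_{n<N} (n+1)·(Λ(n+1) + T(n+1)) + M N + N·(M N − M (N+1)) = G(0) = 1` for every `N`:
the unit charge at the origin is EXACTLY accounted for by the weighted axis Laplacian, the weighted
transverse anisotropy and a (vanishing) tail. [folklore] -/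
theorem axis_sum_rule (N : ℕ) :
    ∑ n ∈ range N, ((n : ℝ) + 1) *
        ((∑ i : Fin 3, (criticalTwoPoint 3 (Pi.single 0 ((n + 1 : ℕ) : ℤ) + Pi.single i 1) +
            criticalTwoPoint 3 (Pi.single 0 ((n + 1 : ℕ) : ℤ) - Pi.single i 1))) -
          6 * criticalTwoPoint 3 (Pi.single 0 ((n + 1 : ℕ) : ℤ)) +
         (4 * criticalTwoPoint 3 (Pi.single 0 ((n + 1 : ℕ) : ℤ)) -
          ((criticalTwoPoint 3 (Pi.single 0 ((n + 1 : ℕ) : ℤ) + Pi.single 1 1) +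
             criticalTwoPoint 3 (Pi.single 0 ((n + 1 : ℕ) : ℤ) - Pi.single 1 1)) +
           (criticalTwoPoint 3 (Pi.single 0 ((n + 1 : ℕ) : ℤ) + Pi.single 2 1) +
             criticalTwoPoint 3 (Pi.single 0 ((n + 1 : ℕ) : ℤ) - Pi.single 2 1))))) +
      criticalTwoPoint 3 (Pi.single 0 (N : ℤ)) +
      N * (criticalTwoPoint 3 (Pi.single 0 (N : ℤ)) - criticalTwoPoint 3 (Pi.single 0 ((N + 1 : ℕ) : ℤ))) = 1 := by
  have h := sum_mul_secondDiff (fun n => criticalTwoPoint 3 (Pi.single 0 (n : ℤ))) N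
  simp only [Nat.cast_zero, Pi.single_zero, criticalTwoPoint_zero'] at h
  have hsum : ∑ n ∈ range N, ((n : ℝ) + 1) *
        ((∑ i : Fin 3, (criticalTwoPoint 3 (Pi.single 0 ((n + 1 : ℕ) : ℤ) + Pi.single i 1) +
            criticalTwoPoint 3 (Pi.single 0 ((n + 1 : ℕ) : ℤ) - Pi.single i 1))) -
          6 * criticalTwoPoint 3 (Pi.single 0 ((n + 1 : ℕ) : ℤ)) +
         (4 * criticalTwoPoint 3 (Pi.single 0 ((n + 1 : ℕ) : ℤ)) -
          ((criticalTwoPoint 3 (Pi.single 0 ((n + 1 : ℕ) : ℤ) + Pi.single 1 1) +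
             criticalTwoPoint 3 (Pi.single 0 ((n + 1 : ℕ) : ℤ) - Pi.single 1 1)) +
           (criticalTwoPoint 3 (Pi.single 0 ((n + 1 : ℕ) : ℤ) + Pi.single 2 1) +
             criticalTwoPoint 3 (Pi.single 0 ((n + 1 : ℕ) : ℤ) - Pi.single 2 1))))) =
      ∑ n ∈ range N, ((n : ℝ) + 1) * (criticalTwoPoint 3 (Pi.single 0 ((n + 2 : ℕ) : ℤ)) -
        2 * criticalTwoPoint 3 (Pi.single 0 ((n + 1 : ℕ) : ℤ)) + criticalTwoPoint 3 (Pi.single 0 (n : ℤ))) :=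
    sum_congr rfl fun n _ => by rw [nbrSum_axis_eq]; ring
  rw [hsum, h]
  ring

/-- **Unconditional bound on the weighted axis Laplacian**: `∑_{n<N} (n+1)·Λ(n+1) < 1` for every `N`
(`T ≥ 0` by Messager–Miracle-Solé, the tail is `> 0` by MMS monotonicity and Simon–Lieb positivity).
So the POSITIVE part of `ΔG` along the axis is small in the mean `∑ n·ΔG(ne₀)`, SubH or not.
[folklore] -/
theorem sum_weighted_axisLaplacian_lt_one (N : ℕ) :
    ∑ n ∈ range N, ((n : ℝ) + 1) *
        ((∑ i : Fin 3, (criticalTwoPoint 3 (Pi.single 0 ((n + 1 : ℕ) : ℤ) + Pi.single i 1) +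
            criticalTwoPoint 3 (Pi.single 0 ((n + 1 : ℕ) : ℤ) - Pi.single i 1))) -
          6 * criticalTwoPoint 3 (Pi.single 0 ((n + 1 : ℕ) : ℤ))) < 1 := by
  have hid := axis_sum_rule N
  have hmono : criticalTwoPoint 3 (Pi.single 0 ((N + 1 : ℕ) : ℤ)) ≤ criticalTwoPoint 3 (Pi.single 0 (N : ℤ)) :=
    criticalTwoPoint_axis_antitone (Nat.le_succ N)
  have hpos : 0 < criticalTwoPoint 3 (Pi.single 0 (N : ℤ)) := criticalTwoPoint_axis_pos N
  have hN : (0 : ℝ) ≤ N := Nat.cast_nonneg N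
  have htail : 0 ≤ (N : ℝ) * (criticalTwoPoint 3 (Pi.single 0 (N : ℤ)) -
      criticalTwoPoint 3 (Pi.single 0 ((N + 1 : ℕ) : ℤ))) := mul_nonneg hN (sub_nonneg.2 hmono)
  calc ∑ n ∈ range N, ((n : ℝ) + 1) *
        ((∑ i : Fin 3, (criticalTwoPoint 3 (Pi.single 0 ((n + 1 : ℕ) : ℤ) + Pi.single i 1) +
            criticalTwoPoint 3 (Pi.single 0 ((n + 1 : ℕ) : ℤ) - Pi.single i 1))) -
          6 * criticalTwoPoint 3 (Pi.single 0 ((n + 1 : ℕ) : ℤ)))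
      ≤ ∑ n ∈ range N, ((n : ℝ) + 1) *
        ((∑ i : Fin 3, (criticalTwoPoint 3 (Pi.single 0 ((n + 1 : ℕ) : ℤ) + Pi.single i 1) +
            criticalTwoPoint 3 (Pi.single 0 ((n + 1 : ℕ) : ℤ) - Pi.single i 1))) -
          6 * criticalTwoPoint 3 (Pi.single 0 ((n + 1 : ℕ) : ℤ)) +
         (4 * criticalTwoPoint 3 (Pi.single 0 ((n + 1 : ℕ) : ℤ)) -
          ((criticalTwoPoint 3 (Pi.single 0 ((n + 1 : ℕ) : ℤ) + Pi.single 1 1) +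
             criticalTwoPoint 3 (Pi.single 0 ((n + 1 : ℕ) : ℤ) - Pi.single 1 1)) +
           (criticalTwoPoint 3 (Pi.single 0 ((n + 1 : ℕ) : ℤ) + Pi.single 2 1) +
             criticalTwoPoint 3 (Pi.single 0 ((n + 1 : ℕ) : ℤ) - Pi.single 2 1))))) := by
        refine sum_le_sum fun n _ => ?_
        obtain ⟨t1, t2, t3, t4⟩ := transverse_nbrs_le (n + 1) (by omega)
        have hw : (0 : ℝ) ≤ (n : ℝ) + 1 := by positivity
        exact mul_le_mul_of_nonneg_left (le_add_of_nonneg_right (by linarith)) hw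
    _ = 1 - (criticalTwoPoint 3 (Pi.single 0 (N : ℤ)) +
      N * (criticalTwoPoint 3 (Pi.single 0 (N : ℤ)) - criticalTwoPoint 3 (Pi.single 0 ((N + 1 : ℕ) : ℤ)))) := by linarith [hid]
    _ < 1 := by linarith

/-- **Under SubH the weighted axis Laplacian is nonnegative with partial sums `≤ 1`**:
`0 ≤ (n+1)·Λ(n+1)` and `∑_{n<N} (n+1)·Λ(n+1) ≤ 1` for all `N` (hence summable with total mass `≤ 1`,
`summable_of_sum_range_le`). Quantitative exact balance: `liminf n²·ΔG(ne₀) = 0`, and no lower bound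
`ΔG(ne₀) ≥ κ/(n² log n)` can hold under SubH. [folklore] -/
theorem weighted_axisLaplacian_of_subharmonicOffOrigin
    (h : Summit.CriticalPhenomena.Ising3DConformalLimit.Theses.PerfectScreening.SubharmonicOffOrigin) :
    (∀ n : ℕ, 0 ≤ ((n : ℝ) + 1) *
        ((∑ i : Fin 3, (criticalTwoPoint 3 (Pi.single 0 ((n + 1 : ℕ) : ℤ) + Pi.single i 1) +
            criticalTwoPoint 3 (Pi.single 0 ((n + 1 : ℕ) : ℤ) - Pi.single i 1))) -
          6 * criticalTwoPoint 3 (Pi.single 0 ((n + 1 : ℕ) : ℤ)))) ∧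
    (∀ N : ℕ, ∑ n ∈ range N, ((n : ℝ) + 1) *
        ((∑ i : Fin 3, (criticalTwoPoint 3 (Pi.single 0 ((n + 1 : ℕ) : ℤ) + Pi.single i 1) +
            criticalTwoPoint 3 (Pi.single 0 ((n + 1 : ℕ) : ℤ) - Pi.single i 1))) -
          6 * criticalTwoPoint 3 (Pi.single 0 ((n + 1 : ℕ) : ℤ))) ≤ 1) := by
  have hnn : ∀ n : ℕ, 0 ≤ ((n : ℝ) + 1) *
      ((∑ i : Fin 3, (criticalTwoPoint 3 (Pi.single 0 ((n + 1 : ℕ) : ℤ) + Pi.single i 1) +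
            criticalTwoPoint 3 (Pi.single 0 ((n + 1 : ℕ) : ℤ) - Pi.single i 1))) -
          6 * criticalTwoPoint 3 (Pi.single 0 ((n + 1 : ℕ) : ℤ))) := by
    intro n
    have hx := h _ (axis_ne_zero (n := n + 1) (by omega))
    exact mul_nonneg (by positivity) (by linarith)
  have hle : ∀ N : ℕ, ∑ n ∈ range N, ((n : ℝ) + 1) *
        ((∑ i : Fin 3, (criticalTwoPoint 3 (Pi.single 0 ((n + 1 : ℕ) : ℤ) + Pi.single i 1) +
            criticalTwoPoint 3 (Pi.single 0 ((n + 1 : ℕ) : ℤ) - Pi.single i 1))) -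
          6 * criticalTwoPoint 3 (Pi.single 0 ((n + 1 : ℕ) : ℤ))) ≤ 1 := fun N => (sum_weighted_axisLaplacian_lt_one N).le
  exact ⟨hnn, hle⟩

/-- Elementary algebra for the log-summability estimate: `c/w² ≤ M`, `Λ ≥ 0` give
`Λ/(w M) ≤ (1/c)·(w Λ)`. [folklore] -/
theorem div_le_weighted_aux (Λ M c w : ℝ) (hΛ : 0 ≤ Λ) (hM : 0 < M) (hc : 0 < c) (hw : 0 < w)
    (hcM : c / w ^ 2 ≤ M) : Λ / (w * M) ≤ (1 / c) * (w * Λ) := by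
  have hcM' : c ≤ w ^ 2 * M := by rwa [div_le_iff₀ (by positivity), mul_comm] at hcM
  rw [div_le_iff₀ (mul_pos hw hM)]
  have key : (1 / c) * (w * Λ) * (w * M) = Λ * ((w ^ 2 * M) / c) := by ring
  rw [key]
  have h1 : 1 ≤ (w ^ 2 * M) / c := by rw [le_div_iff₀ hc, one_mul]; exact hcM'
  nlinarith [mul_le_mul_of_nonneg_left h1 hΛ]

/-- **Log-summability of the RELATIVE axis excess under SubH**: with Simon–Lieb `G(ne₀) ≥ c/n²`,
`∑_{n<N} (ΔG/G)((n+1)e₀)/(n+1) ≤ 1/c` for all `N`. In particular the relative excess cannot stay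
above any `ε > 0` (harmonic series) — a second, quantitative proof that uniformly strict SubH fails.
[folklore] -/
theorem relative_axisLaplacian_logSummable_of_subharmonicOffOrigin
    (h : Summit.CriticalPhenomena.Ising3DConformalLimit.Theses.PerfectScreening.SubharmonicOffOrigin) :
    ∃ C : ℝ, ∀ N : ℕ, ∑ n ∈ range N,
        ((∑ i : Fin 3, (criticalTwoPoint 3 (Pi.single 0 ((n + 1 : ℕ) : ℤ) + Pi.single i 1) +
            criticalTwoPoint 3 (Pi.single 0 ((n + 1 : ℕ) : ℤ) - Pi.single i 1))) -
          6 * criticalTwoPoint 3 (Pi.single 0 ((n + 1 : ℕ) : ℤ))) /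
          (((n : ℝ) + 1) * criticalTwoPoint 3 (Pi.single 0 ((n + 1 : ℕ) : ℤ))) ≤ C := by
  obtain ⟨c, hc, hlow⟩ := simon_axis
  refine ⟨1 / c, fun N => ?_⟩
  have hle := (weighted_axisLaplacian_of_subharmonicOffOrigin h).2 N
  have hterm : ∀ n ∈ range N,
      ((∑ i : Fin 3, (criticalTwoPoint 3 (Pi.single 0 ((n + 1 : ℕ) : ℤ) + Pi.single i 1) +
            criticalTwoPoint 3 (Pi.single 0 ((n + 1 : ℕ) : ℤ) - Pi.single i 1))) -
          6 * criticalTwoPoint 3 (Pi.single 0 ((n + 1 : ℕ) : ℤ))) /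
          (((n : ℝ) + 1) * criticalTwoPoint 3 (Pi.single 0 ((n + 1 : ℕ) : ℤ))) ≤
        (1 / c) * (((n : ℝ) + 1) *
        ((∑ i : Fin 3, (criticalTwoPoint 3 (Pi.single 0 ((n + 1 : ℕ) : ℤ) + Pi.single i 1) +
            criticalTwoPoint 3 (Pi.single 0 ((n + 1 : ℕ) : ℤ) - Pi.single i 1))) -
          6 * criticalTwoPoint 3 (Pi.single 0 ((n + 1 : ℕ) : ℤ)))) := by
    intro n _
    have hx := h _ (axis_ne_zero (n := n + 1) (by omega))
    exact div_le_weighted_aux _ _ c _ (by linarith) (criticalTwoPoint_axis_pos (n + 1)) hc (by positivity) (hlow n)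
  have h1 : ∑ n ∈ range N,
        ((∑ i : Fin 3, (criticalTwoPoint 3 (Pi.single 0 ((n + 1 : ℕ) : ℤ) + Pi.single i 1) +
            criticalTwoPoint 3 (Pi.single 0 ((n + 1 : ℕ) : ℤ) - Pi.single i 1))) -
          6 * criticalTwoPoint 3 (Pi.single 0 ((n + 1 : ℕ) : ℤ))) /
          (((n : ℝ) + 1) * criticalTwoPoint 3 (Pi.single 0 ((n + 1 : ℕ) : ℤ))) ≤
      ∑ n ∈ range N, (1 / c) * (((n : ℝ) + 1) *
        ((∑ i : Fin 3, (criticalTwoPoint 3 (Pi.single 0 ((n + 1 : ℕ) : ℤ) + Pi.single i 1) +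
            criticalTwoPoint 3 (Pi.single 0 ((n + 1 : ℕ) : ℤ) - Pi.single i 1))) -
          6 * criticalTwoPoint 3 (Pi.single 0 ((n + 1 : ℕ) : ℤ)))) := sum_le_sum hterm
  have h2 : ∑ n ∈ range N, (1 / c) * (((n : ℝ) + 1) *
        ((∑ i : Fin 3, (criticalTwoPoint 3 (Pi.single 0 ((n + 1 : ℕ) : ℤ) + Pi.single i 1) +
            criticalTwoPoint 3 (Pi.single 0 ((n + 1 : ℕ) : ℤ) - Pi.single i 1))) -
          6 * criticalTwoPoint 3 (Pi.single 0 ((n + 1 : ℕ) : ℤ)))) = (1 / c) * ∑ n ∈ range N, ((n : ℝ) + 1) *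
        ((∑ i : Fin 3, (criticalTwoPoint 3 (Pi.single 0 ((n + 1 : ℕ) : ℤ) + Pi.single i 1) +
            criticalTwoPoint 3 (Pi.single 0 ((n + 1 : ℕ) : ℤ) - Pi.single i 1))) -
          6 * criticalTwoPoint 3 (Pi.single 0 ((n + 1 : ℕ) : ℤ))) := by
    rw [← mul_sum]
  have h3 : (1 / c) * ∑ n ∈ range N, ((n : ℝ) + 1) *
        ((∑ i : Fin 3, (criticalTwoPoint 3 (Pi.single 0 ((n + 1 : ℕ) : ℤ) + Pi.single i 1) +
            criticalTwoPoint 3 (Pi.single 0 ((n + 1 : ℕ) : ℤ) - Pi.single i 1))) -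
          6 * criticalTwoPoint 3 (Pi.single 0 ((n + 1 : ℕ) : ℤ))) ≤ (1 / c) * 1 :=
    mul_le_mul_of_nonneg_left hle (by positivity)
  linarith [h1, h2, h3]



end Summit.CriticalPhenomena.Ising3DConformalLimit.SubharmonicOffOriginAxisSumRule
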